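import Mathlib
import Summits.NavierStokesRegularity.NavierStokesRegularity.Theorems.TaoLadderRungTwoFlatGappedFrontRobustBehindTailOn
import HarnessLib

/-!
# Shift-set pseudo-flows (`PseudoFlowOnShift 𝕊`): THE QUIET TAIL AHEAD — the shells beyond a window stay
  under an (at most) geometrically decaying amplitude envelope over one clock window, on a TWO-WAY
  nearest-neighbour shift set (helper for item stmt-NavierStokesRegularity-22988 `GappedFrontRobustV2Flat`,
  crux K_B♭ of route TaoLadderRungTwoFlat; serves equally the top-feed step of any finite-window certificate
  on S♭, cf. theory-1's NUM-T28…T31, and is the two-way counterpart of the one-way tail induction of K_B₂)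

**THE AHEAD-TAIL THEOREM `pseudoFlowOnShift_ahead_tail`.** Data: a nearest-neighbour shift set `𝕊`
(possibly two-way: backscatter shifts allowed), `ε₀ ≥ 0`, a pseudo-flow `(S, F)` on `[0, τ]` with motion
defect `κ₁ ≥ 0`, a sub-window `[0, σ]`, a top window shell `kt`, an amplitude ENVELOPE `Z_k > 0` for the
shells `k ≥ kt` decaying AT MOST geometrically, `Z_k ≥ Zmin·(1+ε₀)^{−8k}` beyond the window (this — and
not a Gaussian — is what the a priori class (4.5) can carry, see the K_B♭ note of p1 g11), a bound `Cα`
on the row sums `∑|α_{··i·}|_𝕊`, and defect allowances `δ_k`. Hypotheses: the window's top shell obeys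
`|S_{i,kt}| ≤ Z_kt` on `[0, σ]` (hull clause of a window certificate); the tail STARTS at half envelope;
`κ₁ (1+ε₀)^{2k} √F_{i,k} ≤ δ_k` on `[0,σ]`; and the scalar CLOSING CONDITION per tail shell
`σ · (8 Cα (1+ε₀)^{5k/2} Ẑ_k² + δ_k) ≤ Z_k/2`, `Ẑ_k := max(Z_{k−1}, Z_k, Z_{k+1})` (for a geometric
envelope `Z_k ∝ λ^{−γk/2}` with `γ > 5` the left side decays relative to `Z_k`, so finitely many shells carry
content). Conclusion: `|S_{i,k}(u)| ≤ Z_k` and `|S_{i,k}(u) − S₀_{i,k}| ≤ σ(8 Cα (1+ε₀)^{5k/2} Ẑ_k² + δ_k)`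
for `k > kt`, `u ∈ [0, σ]`.

PROOF. As for the frozen wake (`pseudoFlowOnShift_behind_tail`): the uniform bootstrap lemma
`GappedFrontRobust.bootstrap_family` over the infinite tail family, the uniform RELATIVE Lipschitz constant
now coming from the DECAY of the a priori class, `|S_{i,k}|, √F_{i,k} ≤ M (1+ε₀)^{−10k}`: the clock
`(1+ε₀)^{5k/2}` times two decaying amplitudes is `≤ 2CαM²(1+ε₀)^{20−19kt/2}·(1+ε₀)^{−8k}` and the defect
term is `κ₁ M (1+ε₀)^{−8k}`, both within `Z_k ≥ Zmin (1+ε₀)^{−8k}`.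

HONEST FRAMING: a lemma about Tao-type MODEL lattice pseudo-flows on a general nearest-neighbour shift
set (Tao 2016 §4 Lemma 4.1 (4.5), (4.8); §6.2 Prop. 6.3 (ix) shape: small energies ahead of the front);
nothing here is a statement about the Navier–Stokes equations, nothing is asserted about any table, and
no certificate is produced. p1 g11.
-/

noncomputable section

-- the sub-problem namespace `Summit.NavierStokesRegularity.NavierStokesRegularity` repeats the summit name by design (D-0017)
set_option linter.dupNamespace false

namespace Summit.NavierStokesRegularity.NavierStokesRegularity.Theorems

open Set MeasureTheory intervalIntegral Literature.Analysis.FluidPDE Literature.Analysis.FluidPDE.TaoCascade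

namespace GappedFrontRobustOn

variable {m : ℕ} {𝕊 : Finset (ℤ × ℤ × ℤ)}
variable {τ ε₀ : ℝ} {α : Fin m → Fin m → Fin m → ℤ × ℤ × ℤ → ℝ} {κ₁ κ₂ : ℝ}
  {S₀ F₀ B₀ : Fin m → ℤ → ℝ} {S F : Fin m → ℤ → ℝ → ℝ}

/-- **THE QUIET TAIL AHEAD (two-way nearest-neighbour shift sets).** See the module docstring.
[cite: Tao2016AveragedNS, §4 Lemma 4.1 (4.5), (4.8) and §6.2 Prop. 6.3 (ix) (statement shape)] -/
theorem pseudoFlowOnShift_ahead_tail (h𝕊 : IsNearestNeighbourSet 𝕊)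
    (h : PseudoFlowOnShift 𝕊 τ ε₀ α κ₁ κ₂ S₀ F₀ B₀ S F) (hε : 0 ≤ ε₀) (hκ₁ : 0 ≤ κ₁)
    {σ : ℝ} (hσ : 0 < σ) (hστ : σ ≤ τ) {kt : ℤ} {Z δ : ℤ → ℝ} {Cα Zmin : ℝ}
    (hCα : ∀ i, ∑ i₁, ∑ i₂, ∑ μ ∈ 𝕊, |α i₁ i₂ i μ| ≤ Cα)
    (hZ : ∀ k, kt ≤ k → 0 < Z k) (hZmin : 0 < Zmin)
    (hZlow : ∀ k, kt < k → Zmin * (1 + ε₀) ^ (-(8 : ℝ) * k) ≤ Z k)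
    (hwin : ∀ i, ∀ u ∈ Icc 0 σ, |S i kt u| ≤ Z kt)
    (h0 : ∀ (i : Fin m) (k : ℤ), kt < k → |S₀ i k| ≤ Z k / 2)
    (hδ : ∀ (i : Fin m) (k : ℤ), kt < k → ∀ u ∈ Icc 0 σ,
      κ₁ * (1 + ε₀) ^ ((2 : ℝ) * k) * Real.sqrt (F i k u) ≤ δ k)
    (hclose : ∀ k, kt < k →
      σ * (8 * Cα * (1 + ε₀) ^ ((5 : ℝ) * k / 2) *
        max (Z (k - 1)) (max (Z k) (Z (k + 1))) * max (Z (k - 1)) (max (Z k) (Z (k + 1))) + δ k) ≤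
        Z k / 2) :
    ∀ (i : Fin m) (k : ℤ), kt < k → ∀ u ∈ Icc 0 σ,
      |S i k u| ≤ Z k ∧
        |S i k u - S₀ i k| ≤ σ * (8 * Cα * (1 + ε₀) ^ ((5 : ℝ) * k / 2) *
          max (Z (k - 1)) (max (Z k) (Z (k + 1))) * max (Z (k - 1)) (max (Z k) (Z (k + 1))) + δ k) := by
  have hq : 0 < 1 + ε₀ := by linarith
  have hq1 : 1 ≤ 1 + ε₀ := by linarith
  set zh : ℤ → ℝ := fun k => max (Z (k - 1)) (max (Z k) (Z (k + 1))) with hzh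
  have hzh_ge : ∀ j k, j - 1 ≤ k → k ≤ j + 1 → Z k ≤ zh j := by
    intro j k hk1 hk2
    have hk : k = j - 1 ∨ k = j ∨ k = j + 1 := by omega
    rcases hk with rfl | rfl | rfl
    · exact le_max_left _ _
    · exact (le_max_left _ _).trans (le_max_right _ _)
    · exact (le_max_right _ _).trans (le_max_right _ _)
  have hzh_pos : ∀ k, kt < k → 0 < zh k := fun k hk =>
    lt_of_lt_of_le (hZ k hk.le) (hzh_ge k k (by omega) (by omega))
  have hσ' := pseudoFlowOnShift_mono h hσ hστ
  obtain ⟨M, hM0, hM⟩ := pseudoFlowOnShift_uniform_bounds hσ' hq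
  intro i₀ k₀ hk₀ u₀ hu₀
  have hCα0 : 0 ≤ Cα := le_trans (Finset.sum_nonneg fun _ _ => Finset.sum_nonneg fun _ _ =>
    Finset.sum_nonneg fun _ _ => abs_nonneg _) (hCα i₀)
  have hδ0 : ∀ k, kt < k → 0 ≤ δ k := fun k hk =>
    le_trans (mul_nonneg (mul_nonneg hκ₁ (Real.rpow_pos_of_pos hq _).le) (Real.sqrt_nonneg _))
      (hδ i₀ k hk 0 (left_mem_Icc.2 hσ.le))
  -- ONE relative Lipschitz constant for every tail amplitude, from the DECAY of the a priori class
  set C₁ : ℝ := 2 * Cα * M * M * (1 + ε₀) ^ ((20 : ℝ) - 19 * kt / 2) + κ₁ * M with hC₁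
  have hC₁0 : 0 ≤ C₁ := by positivity
  -- exponent bookkeeping
  have hexp : ∀ k : ℤ, kt < k →
      (1 + ε₀) ^ ((5 : ℝ) * k / 2) * ((1 + ε₀) ^ (-(10 : ℝ) * ((k - 1 : ℤ) : ℝ)) *
        (1 + ε₀) ^ (-(10 : ℝ) * ((k - 1 : ℤ) : ℝ))) ≤
        (1 + ε₀) ^ ((20 : ℝ) - 19 * kt / 2) * (1 + ε₀) ^ (-(8 : ℝ) * k) := by
    intro k hk
    rw [← Real.rpow_add hq, ← Real.rpow_add hq, ← Real.rpow_add hq]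
    refine Real.rpow_le_rpow_of_exponent_le hq1 ?_
    have : (kt : ℝ) + 1 ≤ k := by exact_mod_cast hk
    push_cast
    linarith
  have hlipS : ∀ (i : Fin m) (k : ℤ), kt < k → ∀ s ∈ Icc 0 σ, ∀ t ∈ Icc 0 σ,
      |S i k t - S i k s| ≤ C₁ * (1 + ε₀) ^ (-(8 : ℝ) * k) * |t - s| := by
    intro i k hk s hs t ht
    refine pseudoFlowOnShift_abs_sub_le hσ' i k (fun u hu => ?_) hs ht
    -- the three shells k-1, k, k+1 carry amplitudes ≤ M (1+ε₀)^{-10(k-1)}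
    have hA : ∀ (i' : Fin m) (k' : ℤ), k - 1 ≤ k' → k' ≤ k + 1 →
        |S i' k' u| ≤ M * (1 + ε₀) ^ (-(10 : ℝ) * ((k - 1 : ℤ) : ℝ)) := by
      intro i' k' hk1 hk2
      refine ((hM u hu i' k').2.1).trans (mul_le_mul_of_nonneg_left ?_ hM0)
      refine Real.rpow_le_rpow_of_exponent_le hq1 ?_
      have : ((k - 1 : ℤ) : ℝ) ≤ k' := by exact_mod_cast hk1
      linarith
    have hA0 : 0 ≤ M * (1 + ε₀) ^ (-(10 : ℝ) * ((k - 1 : ℤ) : ℝ)) :=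
      mul_nonneg hM0 (Real.rpow_pos_of_pos hq _).le
    have h1 := abs_quadTermOn_le_three_shell h𝕊 hε α S i k u hA0 hA
    have hs0 : 0 ≤ ∑ i₁, ∑ i₂, ∑ μ ∈ 𝕊, |α i₁ i₂ i μ| := Finset.sum_nonneg fun _ _ =>
      Finset.sum_nonneg fun _ _ => Finset.sum_nonneg fun _ _ => abs_nonneg _
    have hΛ0 : 0 ≤ (1 + ε₀) ^ ((5 : ℝ) * k / 2) := (Real.rpow_pos_of_pos hq _).le
    -- quadratic part
    have h2 : 2 * (∑ i₁, ∑ i₂, ∑ μ ∈ 𝕊, |α i₁ i₂ i μ|) * (1 + ε₀) ^ ((5 : ℝ) * k / 2) *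
        (M * (1 + ε₀) ^ (-(10 : ℝ) * ((k - 1 : ℤ) : ℝ))) * (M * (1 + ε₀) ^ (-(10 : ℝ) * ((k - 1 : ℤ) : ℝ))) ≤
        2 * Cα * M * M * (1 + ε₀) ^ ((20 : ℝ) - 19 * kt / 2) * (1 + ε₀) ^ (-(8 : ℝ) * k) := by
      have e : 2 * (∑ i₁, ∑ i₂, ∑ μ ∈ 𝕊, |α i₁ i₂ i μ|) * (1 + ε₀) ^ ((5 : ℝ) * k / 2) *
          (M * (1 + ε₀) ^ (-(10 : ℝ) * ((k - 1 : ℤ) : ℝ))) *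
            (M * (1 + ε₀) ^ (-(10 : ℝ) * ((k - 1 : ℤ) : ℝ))) =
          2 * (∑ i₁, ∑ i₂, ∑ μ ∈ 𝕊, |α i₁ i₂ i μ|) * M * M *
            ((1 + ε₀) ^ ((5 : ℝ) * k / 2) * ((1 + ε₀) ^ (-(10 : ℝ) * ((k - 1 : ℤ) : ℝ)) *
              (1 + ε₀) ^ (-(10 : ℝ) * ((k - 1 : ℤ) : ℝ)))) := by ring
      rw [e]
      have hx := hexp k hk
      have hpre : 0 ≤ 2 * (∑ i₁, ∑ i₂, ∑ μ ∈ 𝕊, |α i₁ i₂ i μ|) * M * M := by positivity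
      have hpre' : 2 * (∑ i₁, ∑ i₂, ∑ μ ∈ 𝕊, |α i₁ i₂ i μ|) * M * M ≤ 2 * Cα * M * M := by
        have := hCα i; nlinarith [mul_nonneg hM0 hM0]
      have hy0 : 0 ≤ (1 + ε₀) ^ ((20 : ℝ) - 19 * kt / 2) * (1 + ε₀) ^ (-(8 : ℝ) * k) :=
        mul_nonneg (Real.rpow_pos_of_pos hq _).le (Real.rpow_pos_of_pos hq _).le
      calc 2 * (∑ i₁, ∑ i₂, ∑ μ ∈ 𝕊, |α i₁ i₂ i μ|) * M * M *
            ((1 + ε₀) ^ ((5 : ℝ) * k / 2) * ((1 + ε₀) ^ (-(10 : ℝ) * ((k - 1 : ℤ) : ℝ)) *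
              (1 + ε₀) ^ (-(10 : ℝ) * ((k - 1 : ℤ) : ℝ))))
          ≤ 2 * (∑ i₁, ∑ i₂, ∑ μ ∈ 𝕊, |α i₁ i₂ i μ|) * M * M *
              ((1 + ε₀) ^ ((20 : ℝ) - 19 * kt / 2) * (1 + ε₀) ^ (-(8 : ℝ) * k)) :=
            mul_le_mul_of_nonneg_left hx hpre
        _ ≤ 2 * Cα * M * M * ((1 + ε₀) ^ ((20 : ℝ) - 19 * kt / 2) * (1 + ε₀) ^ (-(8 : ℝ) * k)) :=
            mul_le_mul_of_nonneg_right hpre' hy0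
        _ = _ := by ring
    -- defect part: κ₁ λ^{2k} √F ≤ κ₁ λ^{2k} M λ^{-10k} = κ₁ M λ^{-8k}
    have h3 : κ₁ * (1 + ε₀) ^ ((2 : ℝ) * k) * Real.sqrt (F i k u) ≤
        κ₁ * M * (1 + ε₀) ^ (-(8 : ℝ) * k) := by
      have hF := (hM u hu i k).2.2.2
      have h2pos : 0 ≤ (1 + ε₀) ^ ((2 : ℝ) * k) := (Real.rpow_pos_of_pos hq _).le
      calc κ₁ * (1 + ε₀) ^ ((2 : ℝ) * k) * Real.sqrt (F i k u)
          ≤ κ₁ * (1 + ε₀) ^ ((2 : ℝ) * k) * (M * (1 + ε₀) ^ (-(10 : ℝ) * k)) :=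
            mul_le_mul_of_nonneg_left hF (mul_nonneg hκ₁ h2pos)
        _ = κ₁ * M * ((1 + ε₀) ^ ((2 : ℝ) * k) * (1 + ε₀) ^ (-(10 : ℝ) * k)) := by ring
        _ = κ₁ * M * (1 + ε₀) ^ (-(8 : ℝ) * k) := by
            rw [← Real.rpow_add hq]; ring_nf
    have e1 : C₁ * (1 + ε₀) ^ (-(8 : ℝ) * k) =
        2 * Cα * M * M * (1 + ε₀) ^ ((20 : ℝ) - 19 * kt / 2) * (1 + ε₀) ^ (-(8 : ℝ) * k) +
          κ₁ * M * (1 + ε₀) ^ (-(8 : ℝ) * k) := by simp only [hC₁]; ring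
    rw [e1]
    linarith
  -- the improvement step (identical to the frozen wake)
  have improve : ∀ t ∈ Icc 0 σ,
      (∀ (i : Fin m) (k : ℤ), kt < k → ∀ s ∈ Icc 0 t, |S i k s| ≤ 2 * Z k) →
        ∀ (i : Fin m) (k : ℤ), kt < k →
          |S i k t - S₀ i k| ≤ t * (8 * Cα * (1 + ε₀) ^ ((5 : ℝ) * k / 2) * zh k * zh k + δ k) := by
    intro t ht hyp i k hk
    rcases eq_or_lt_of_le ht.1 with ht0 | ht0
    · rw [← ht0, h.init_S, sub_self, abs_zero, zero_mul]
    have hflow := pseudoFlowOnShift_mono h ht0 (ht.2.trans hστ)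
    have hA : ∀ s ∈ Icc 0 t, ∀ (i' : Fin m) (k' : ℤ), k - 1 ≤ k' → k' ≤ k + 1 →
        |S i' k' s| ≤ 2 * zh k := by
      intro s hs i' k' hk1 hk2
      have hzk := hzh_ge k k' hk1 hk2
      rcases lt_or_ge kt k' with hk' | hk'
      · exact (hyp i' k' hk' s hs).trans (by linarith)
      · have hkeq : k' = kt := by omega
        subst hkeq
        have := hwin i' s ⟨hs.1, hs.2.trans ht.2⟩
        linarith [hZ k' le_rfl]
    have hd := pseudoFlowOnShift_drift_le h𝕊 hflow hε ht0 i k (A := 2 * zh k) (Cα := Cα) (δ := δ k)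
      (by linarith [hzh_pos k hk]) (hCα i) hA (fun s hs => hδ i k hk s ⟨hs.1, hs.2.trans ht.2⟩)
    refine hd.trans (le_of_eq ?_)
    ring
  -- continuous induction over the infinite tail family
  have key := GappedFrontRobust.bootstrap_family (ι := Fin m × {k : ℤ // kt < k})
    (u := fun ik t => |S ik.1 ik.2.1 t|) (p := fun ik => Z ik.2.1) (ψ := fun _ => (1 : ℝ))
    (τ := σ) (L := C₁ / Zmin)
    (fun ik => (hZ ik.2.1 ik.2.2.le).le) (div_nonneg hC₁0 hZmin.le) continuousOn_const
    (fun _ _ => one_pos)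
    (by
      rintro ⟨i, k, hk⟩ s hs t ht
      have h1 := abs_abs_sub_abs_le_abs_sub (S i k t) (S i k s)
      have h2 := hlipS i k hk s hs t ht
      have h3 : C₁ * (1 + ε₀) ^ (-(8 : ℝ) * k) ≤ C₁ / Zmin * Z k := by
        rw [div_mul_eq_mul_div, le_div_iff₀ hZmin]
        calc C₁ * (1 + ε₀) ^ (-(8 : ℝ) * k) * Zmin = C₁ * (Zmin * (1 + ε₀) ^ (-(8 : ℝ) * k)) := by
              ring
          _ ≤ C₁ * Z k := mul_le_mul_of_nonneg_left (hZlow k hk) hC₁0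
      have h4 : C₁ * (1 + ε₀) ^ (-(8 : ℝ) * k) * |t - s| ≤ C₁ / Zmin * Z k * |t - s| :=
        mul_le_mul_of_nonneg_right h3 (abs_nonneg _)
      exact h1.trans (h2.trans h4))
    (by
      rintro ⟨i, k, hk⟩
      simp only [one_mul, h.init_S]
      linarith [h0 i k hk, hZ k hk.le])
    (by
      rintro t ht hyp ⟨i, k, hk⟩
      have hyp' : ∀ (i : Fin m) (k : ℤ), kt < k → ∀ s ∈ Icc 0 t, |S i k s| ≤ 2 * Z k :=
        fun i' k' hk' s hs => by simpa using hyp ⟨i', k', hk'⟩ s hs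
      have hd := improve t ht hyp' i k hk
      have hcl := hclose k hk
      have hrate : 0 ≤ 8 * Cα * (1 + ε₀) ^ ((5 : ℝ) * k / 2) * zh k * zh k + δ k := by
        have := hzh_pos k hk; have := hδ0 k hk; positivity
      have htσ : t * (8 * Cα * (1 + ε₀) ^ ((5 : ℝ) * k / 2) * zh k * zh k + δ k) ≤
          σ * (8 * Cα * (1 + ε₀) ^ ((5 : ℝ) * k / 2) * zh k * zh k + δ k) :=
        mul_le_mul_of_nonneg_right ht.2 hrate
      have htri : |S i k t| ≤ |S₀ i k| + |S i k t - S₀ i k| := by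
        have := abs_add_le (S₀ i k) (S i k t - S₀ i k); rwa [add_sub_cancel] at this
      simp only [one_mul]
      linarith [h0 i k hk])
  have hall : ∀ (i : Fin m) (k : ℤ), kt < k → ∀ s ∈ Icc 0 σ, |S i k s| ≤ Z k :=
    fun i k hk s hs => by simpa using key ⟨i, k, hk⟩ s hs
  refine ⟨hall i₀ k₀ hk₀ u₀ hu₀, ?_⟩
  have hd := improve u₀ hu₀ (fun i k hk s hs => (hall i k hk s ⟨hs.1, hs.2.trans hu₀.2⟩).trans
    (by linarith [hZ k hk.le])) i₀ k₀ hk₀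
  have hrate : 0 ≤ 8 * Cα * (1 + ε₀) ^ ((5 : ℝ) * k₀ / 2) * zh k₀ * zh k₀ + δ k₀ := by
    have := hzh_pos k₀ hk₀; have := hδ0 k₀ hk₀; positivity
  exact hd.trans (mul_le_mul_of_nonneg_right hu₀.2 hrate)

end GappedFrontRobustOn

end Summit.NavierStokesRegularity.NavierStokesRegularity.Theorems

end
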